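import Summits.ABC.ABC.Theorems.CubicResolventAllowanceResolventDiscBounds

/-!
# STUB-IDEAS k1 · gen 16 — companion sketch for `stub_complexCubic` (crux stmt-ABC-22740 `IndexSzpiro`)

Contents (all kernel-checked, no `sorry`):

* `Stub` — the stub VERBATIM (payload.stub.signature), re-elaborated against the current tree;
* `StubSgn s` / `StubSgnLoose s` — the stub inequality with an arbitrary sign condition
  `s (d_K)` and with the allowance `|d_K|` resp. the LOOSE allowance `|d_K| ^ (1 + ε)`;
* `stubSgn_iff_loose` — **U1 for both signs, PROVED**: `StubSgn s ↔ StubSgnLoose s`, from the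
  LANDED support `Summit.ABC.ABC.Theorems.resolventDiscBounds_proof` (`|d_K| ≤ 1944·N²`):
  the exponent `1` on the resolvent discriminant is not load-bearing — the per-field constant may
  grow like `|d_K|^{o(1)}` for free (this discharges the sorried `stubReal_iff_loose` of
  `StubIdeas2RealG6Sketch.lean` and gives the complex-sign analogue `stub_iff_loose`);
* `stub_iff_stubSgn` — `Stub ↔ StubSgn (· < 0)` (definitional).

Use: barrier placement of the stub against `Literature.Barriers.ABC.UniformABCDiscriminantSharp`
(Masser 2002: in UNIFORM abc over fields of fixed degree the discriminant exponent `μ = 1` times a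
power of `log` is impossible, `μ > 1` "still possible"): the stub is equivalent to every
`μ = 1 + δ` loosening, so no exponent-bookkeeping transport of Masser's theorem reaches it.
See `STUB-IDEAS-stub_complexCubic-1.md` (gen 16); no claim on the stub (verdict `open-problem`).
-/

-- `Summit.ABC.ABC` is the mandated summit-side namespace (single-conjunct summit).
set_option linter.dupNamespace false

namespace Summit.ABC.ABC.Cruxes.IndexSzpiro.StubIdeas1G16

open Polynomial Literature.Abc Summit.ABC.ABC.Theses.CubicResolventAllowance

/-- The stub, verbatim (payload.stub.signature). -/
def Stub : Prop :=
  ∀ ε : ℝ, 0 < ε → ∃ C : ℝ, ∀ (W : WeierstrassCurve ℚ) [W.IsElliptic] (K : Type) [Field K]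
    [NumberField K], Irreducible W.twoTorsionPolynomial.toPoly → Module.finrank ℚ K = 3 →
    (∃ θ : K, aeval θ W.twoTorsionPolynomial.toPoly = 0) → NumberField.discr K < 0 →
    (W.minimalDiscriminantNorm ℤ : ℝ) ≤
      C * |(NumberField.discr K : ℝ)| * (W.conductorNorm ℤ : ℝ) ^ (6 + ε)

/-- The stub inequality on the cubic-resolvent class cut out by a sign condition `s (d_K)`
(`s = (· < 0)`: `stub_complexCubic`; `s = (0 < ·)`: `stub_realCubic`; `s = ⊤`: `IndexSzpiro`). -/
def StubSgn (s : ℤ → Prop) : Prop :=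
  ∀ ε : ℝ, 0 < ε → ∃ C : ℝ, ∀ (W : WeierstrassCurve ℚ) [W.IsElliptic] (K : Type) [Field K]
    [NumberField K], Irreducible W.twoTorsionPolynomial.toPoly → Module.finrank ℚ K = 3 →
    (∃ θ : K, aeval θ W.twoTorsionPolynomial.toPoly = 0) → s (NumberField.discr K) →
    (W.minimalDiscriminantNorm ℤ : ℝ) ≤
      C * |(NumberField.discr K : ℝ)| * (W.conductorNorm ℤ : ℝ) ^ (6 + ε)

/-- The same with the LOOSE allowance `|d_K| ^ (1 + ε)`. -/
def StubSgnLoose (s : ℤ → Prop) : Prop :=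
  ∀ ε : ℝ, 0 < ε → ∃ C : ℝ, ∀ (W : WeierstrassCurve ℚ) [W.IsElliptic] (K : Type) [Field K]
    [NumberField K], Irreducible W.twoTorsionPolynomial.toPoly → Module.finrank ℚ K = 3 →
    (∃ θ : K, aeval θ W.twoTorsionPolynomial.toPoly = 0) → s (NumberField.discr K) →
    (W.minimalDiscriminantNorm ℤ : ℝ) ≤
      C * |(NumberField.discr K : ℝ)| ^ (1 + ε) * (W.conductorNorm ℤ : ℝ) ^ (6 + ε)

/-- `Stub` is `StubSgn (· < 0)` (definitional). -/
theorem stub_iff_stubSgn : Stub ↔ StubSgn (· < 0) := Iff.rfl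

/-- **U1 (both signs, PROVED).** The allowance exponent is free: `StubSgn s ↔ StubSgnLoose s`.
`→`: `|d_K| ≤ |d_K|^{1+ε}` since `|d_K| ≥ 1`.  `←`: apply the loose form with `ε/4` and absorb
`|d_K|^{ε/4} ≤ (1944 N²)^{ε/4} = 1944^{ε/4} N^{ε/2}` (landed `resolventDiscBounds_proof`) into the
conductor power: `|d_K|^{1+ε/4} N^{6+ε/4} ≤ 1944^{ε/4} |d_K| N^{6+3ε/4} ≤ 1944^{ε/4} |d_K| N^{6+ε}`.
[folklore] -/
theorem stubSgn_iff_loose (s : ℤ → Prop) : StubSgn s ↔ StubSgnLoose s := by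
  have hdisc := (Summit.ABC.ABC.Theorems.resolventDiscBounds_proof).1
  constructor
  · intro h ε hε
    obtain ⟨C, hC⟩ := h ε hε
    refine ⟨max C 0, fun W _ K _ _ hirr hdeg hθ hs => ?_⟩
    have h1 := hC W K hirr hdeg hθ hs
    have hd1 : (1 : ℝ) ≤ |(NumberField.discr K : ℝ)| := by
      exact_mod_cast Int.one_le_abs (NumberField.discr_ne_zero K)
    have hN : (0 : ℝ) ≤ (W.conductorNorm ℤ : ℝ) ^ (6 + ε) := by positivity
    have hdd : |(NumberField.discr K : ℝ)| ≤ |(NumberField.discr K : ℝ)| ^ (1 + ε) := by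
      calc |(NumberField.discr K : ℝ)| = |(NumberField.discr K : ℝ)| ^ (1 : ℝ) :=
            (Real.rpow_one _).symm
        _ ≤ |(NumberField.discr K : ℝ)| ^ (1 + ε) :=
            Real.rpow_le_rpow_of_exponent_le hd1 (by linarith)
    calc (W.minimalDiscriminantNorm ℤ : ℝ)
        ≤ C * |(NumberField.discr K : ℝ)| * (W.conductorNorm ℤ : ℝ) ^ (6 + ε) := h1
      _ ≤ max C 0 * |(NumberField.discr K : ℝ)| * (W.conductorNorm ℤ : ℝ) ^ (6 + ε) := by
            gcongr
            exact le_max_left _ _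
      _ ≤ max C 0 * |(NumberField.discr K : ℝ)| ^ (1 + ε) * (W.conductorNorm ℤ : ℝ) ^ (6 + ε) :=
            mul_le_mul_of_nonneg_right (mul_le_mul_of_nonneg_left hdd (le_max_right _ _)) hN
  · intro h ε hε
    obtain ⟨C, hC⟩ := h (ε / 4) (by positivity)
    refine ⟨max C 0 * (1944 : ℝ) ^ (ε / 4), fun W _ K _ _ hirr hdeg hθ hs => ?_⟩
    have h1 := hC W K hirr hdeg hθ hs
    have hdle := hdisc W K hirr hdeg hθ
    have hNpos : 0 < W.conductorNorm ℤ := W.conductorNorm_pos_holds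
    have h1le : 1 ≤ W.conductorNorm ℤ := by omega
    have hN1 : (1 : ℝ) ≤ (W.conductorNorm ℤ : ℝ) := by exact_mod_cast h1le
    have hd0 : 0 < |(NumberField.discr K : ℝ)| :=
      abs_pos.mpr (by exact_mod_cast NumberField.discr_ne_zero K)
    set d : ℝ := |(NumberField.discr K : ℝ)| with hd_def
    set N : ℝ := (W.conductorNorm ℤ : ℝ) with hN_def
    have hN0 : 0 < N := by linarith
    have s2 : d ^ (1 + ε / 4) = d * d ^ (ε / 4) := by
      rw [Real.rpow_add hd0, Real.rpow_one]
    have s3 : d ^ (ε / 4) ≤ (1944 : ℝ) ^ (ε / 4) * N ^ (ε / 2) := by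
      calc d ^ (ε / 4) ≤ (1944 * N ^ (2 : ℕ)) ^ (ε / 4) :=
            Real.rpow_le_rpow hd0.le hdle (by positivity)
        _ = (1944 : ℝ) ^ (ε / 4) * (N ^ (2 : ℕ)) ^ (ε / 4) :=
            Real.mul_rpow (by norm_num) (by positivity)
        _ = (1944 : ℝ) ^ (ε / 4) * N ^ (ε / 2) := by
            rw [← Real.rpow_two, ← Real.rpow_mul hN0.le]
            congr 1
            congr 1
            ring
    calc (W.minimalDiscriminantNorm ℤ : ℝ)
        ≤ C * d ^ (1 + ε / 4) * N ^ (6 + ε / 4) := h1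
      _ ≤ max C 0 * d ^ (1 + ε / 4) * N ^ (6 + ε / 4) := by
            gcongr
            exact le_max_left _ _
      _ = max C 0 * d * d ^ (ε / 4) * N ^ (6 + ε / 4) := by rw [s2]; ring
      _ ≤ max C 0 * d * ((1944 : ℝ) ^ (ε / 4) * N ^ (ε / 2)) * N ^ (6 + ε / 4) := by
            gcongr
      _ = max C 0 * (1944 : ℝ) ^ (ε / 4) * d * N ^ (6 + 3 * ε / 4) := by
            rw [show (6 + 3 * ε / 4 : ℝ) = ε / 2 + (6 + ε / 4) by ring,
              Real.rpow_add hN0 (ε / 2) (6 + ε / 4)]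
            ring
      _ ≤ max C 0 * (1944 : ℝ) ^ (ε / 4) * d * N ^ (6 + ε) := by
            gcongr
            linarith

/-- U1 for the complex sign: `Stub ↔ StubSgnLoose (· < 0)`. -/
theorem stub_iff_loose : Stub ↔ StubSgnLoose (· < 0) :=
  stub_iff_stubSgn.trans (stubSgn_iff_loose _)

/-- Sanity: `Stub` is the `d_K < 0` half of the crux (trivial direction of the registered
composition `IndexSzpiro_of : stub_complexCubic → stub_realCubic → IndexSzpiro`). -/
theorem stub_of_indexSzpiro (h : IndexSzpiro) : Stub := by
  intro ε hε
  obtain ⟨C, hC⟩ := h ε hε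
  exact ⟨C, fun W _ K _ _ hirr hdeg hroot _ => hC W K hirr hdeg hroot⟩

end Summit.ABC.ABC.Cruxes.IndexSzpiro.StubIdeas1G16
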